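import Literature.MathematicalPhysics.QuantumFieldTheory.Balaban1983to89.B1Eq324BenfattoKernelSect5LowerAssembly
import HarnessLib

/-!
# `Balaban1983to89.B1Eq324BenfattoKernelSect5LowerAssemblyStop` — [BenfattoEtAl1978] p. 152 (4.7), §5 p. 154 «After (d + 1) steps … we end up in the free
# case», p. 159 «Collecting all the errors», for the class of [Balaban1985BackgroundPropagators] Sect. E p. 428: seat n08-c's class (4.7) knit
# `…KernelSect5LowerAssembly.exp_cumulantSum_sub_le_integral_of_ledger` RE-RUN AT THE STOPPING INDEX — `m` steps with `J_m = ∅` in place of `d + 1` steps with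
# the separation hypothesis — PROVED

statement-level skeleton of published theorems with citation tags; proofs where landed; nothing here is a claim about the
Yang–Mills mass gap

WHY THIS MODULE (cell `pub-ymgap`, seat `dag-n08-b` gen 13; node N08 [Balaban1985UV3]).  The knit of record (p622797, seat n08-c) runs the class chain for a
FIXED `d + 1` steps with boxes `B_k = (J_k + τ_k).image boxIndex` and concludes `J_{d+1} = ∅` from the separation of the cumulative displacements.  For
generic data the chain EMPTIES EARLIER (a one-point `J₀ = {x}` has `J₁ = ({x+τ₀}) ∩ Γ̄₁(B₀) = ∅` whenever `x + τ₀` lies in a box interior), and at a step with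
`J_k = ∅` the class price `2P_k` displayed by seat n08-d's `lowerPavementChain` is |Λ|-EXTENSIVE (`B_k = ∅`, `d(Δ, ∅) = 0` junk, `r_y = J_c/(cosh θw − 1)` at
every site of the frame): the knit's `hledger` cannot then be met by any `|I|·errTerm`.  Print's «after (d+1) steps we end up in the free case» is really
«after AT MOST d+1 steps»: this file states the knit for ANY number `m` of steps with the terminal hypothesis `J_m = ∅` (the caller takes `m :=` the first
empty index, `≤ d + 1` by `…Sect5PavementChain.chain_eq_empty_of_sep`), so that every `B_k`, `k < m`, is non-empty and the nI-form ledger of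
`…KernelSect5LedgerDischargeLower.lowerpack_class` (seat n08-b, uniform in the stopping index `m ≤ d+1`) applies.  The proof is seat n08-c's, verbatim,
with seat n08-d's driver at the stopping index `lowerPavementChain_appendixA_of_eq_empty` (p625437, `…KernelSect5PavementChain` v1.1 §5,
consumed BY NAME) in place of `lowerPavementChain_appendixA`.

WHAT IS PROVED (one theorem, no definition, no named fact, no `sorry`; axioms standard): ★★★ `exp_cumulantSum_sub_le_integral_of_ledger_stop` — binders =
p622797's with `∀ k < d+1 ↦ ∀ k < m`, `hsep` REPLACED by `(hJm : Js m = ∅) (hbpos : 0 < bs m)`, `hbterm` and the Appendix-A term at `bs m`, `hledger` over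
`Finset.range m`; conclusion identical: `exp(cumulantSum μ_K H^{A_0}_{J_0} t − E_tot) ≤ ∫Π_Δχ̂^{I_0}_{b_0} e^{H^{A_0}_{J_0}} dμ_K`.

HONEST SCOPE / NOT HERE.  A re-quantification of a landed knit (no new estimate); the conversion of its `hledger` to nI-form, the choice of `m`, and the class
Basic Lemma are NOT here; count-neutral for N08; nothing of [Balaban1985UV3] (41)/(47)/(5) is asserted; nothing about d = 4, the continuum, OS axioms, a
mass gap or the Clay problem.
-/

noncomputable section

open MeasureTheory ProbabilityTheory Finset Matrix
open scoped BigOperators Nat NNReal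

namespace Literature.MathematicalPhysics.QuantumFieldTheory.Balaban1983to89.B1Eq324BenfattoKernelSect5LowerAssemblyStop

open _root_.MeasureTheory _root_.ProbabilityTheory
open Literature.Probability.LatticeModels (setPartitions)
open Literature.MathematicalPhysics.QuantumFieldTheory
open Literature.MathematicalPhysics.QuantumFieldTheory.Balaban1983to89.B1Eq324BenfattoLemma
open Literature.MathematicalPhysics.QuantumFieldTheory.Balaban1983to89.B1Eq324BenfattoSect5Boxes
open Literature.MathematicalPhysics.QuantumFieldTheory.Balaban1983to89.B1Eq324BenfattoSect5Eq511
open Literature.MathematicalPhysics.QuantumFieldTheory.Balaban1983to89.B1Eq324BenfattoSect5Eq524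
open Literature.MathematicalPhysics.QuantumFieldTheory.Balaban1983to89.B1Eq324BenfattoSect5Eq534
open Literature.MathematicalPhysics.QuantumFieldTheory.Balaban1983to89.B1Eq324BenfattoSect5Eq515
open Literature.MathematicalPhysics.QuantumFieldTheory.Balaban1983to89.B1Eq324BenfattoSect5Iteration (restrictCoef shiftCoef)
open Literature.MathematicalPhysics.QuantumFieldTheory.Balaban1983to89.B1Eq324BenfattoKernelOfPrecision (isPosSemidefKernel_kernel)
open Literature.MathematicalPhysics.QuantumFieldTheory.Balaban1983to89.B1Eq324BenfattoClassAppendixC (posDef_of_coercive)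
open Literature.MathematicalPhysics.QuantumFieldTheory.Balaban1983to89.B1Eq324BenfattoKernelSect5Iteration (mem_image_sub_iff)
open Literature.MathematicalPhysics.QuantumFieldTheory.Balaban1983to89.B1Eq324BenfattoKernelSect5PavementChain (lowerPavementChain_appendixA_of_eq_empty)
open Literature.MathematicalPhysics.QuantumFieldTheory.Balaban1983to89.B1Eq324BenfattoKernelSect5ClassLowerStepFrame (exists_lower_step_of_classRows_frame)
open Literature.MathematicalPhysics.QuantumFieldTheory.Balaban1983to89.B1Eq324BenfattoKernelSect5CollectErrors (exp_cumulantSum_sub_le_integral_of_chain)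
open Literature.MathematicalPhysics.QuantumFieldTheory.Balaban1983to89.B1Eq324BenfattoSect5PavementChain (chain_invariants)
open Literature.MathematicalPhysics.QuantumFieldTheory.Balaban1983to89.B1Eq324GaussianMomentLeaf (momentConst)

variable {d : ℕ}

section Assembly

variable {Λ : Finset (B1Eq324BenfattoLemma.Site d)} {A : Matrix Λ Λ ℝ}
  {K : B1Eq324BenfattoLemma.Site d → B1Eq324BenfattoLemma.Site d → ℝ}
  (hK : ∀ x y, K x y = if h : x ∈ Λ ∧ y ∈ Λ then (A⁻¹ : Matrix Λ Λ ℝ) ⟨x, h.1⟩ ⟨y, h.2⟩ else 0)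
  {s D : ℕ} {κ : ℝ} {L w v : ℕ} {γ Ac : ℝ}

include hK

/-- ★★★ **(4.7) FOR THE GAUSSIAN FIELD OF A CLASS KERNEL AT THE STOPPING INDEX** — seat n08-c's `exp_cumulantSum_sub_le_integral_of_ledger` for `m`
displaced class pavement steps with `J_m = ∅` (instead of `d + 1` steps and separated displacements): same rows, chain data for `k < m`, the terminal
cut-off `0 < b_m`, `b_m² ≥ 4/γ_A`, and the LEDGER `Σ_{k<m}(c_k + idErr_k) + |I_0|·4·8^d·e^{−b_m²/(2/γ_A)} ≤ E_tot` ⊢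
`exp(cumulantSum μ_K H^{A_0}_{J_0} t − E_tot) ≤ ∫Π_Δχ̂^{I_0}_{b_0} e^{H^{A_0}_{J_0}} dμ_K`.  Proof: `…KernelSect5PavementChain.lowerPavementChain_appendixA_of_eq_empty` (`m` steps,
`J_m = ∅`, class Appendix A at the terminal frame) with `ℓ_k` chosen from `…ClassLowerStepFrame.exists_lower_step_of_classRows_frame`, then
`…KernelSect5CollectErrors.exp_cumulantSum_sub_le_integral_of_chain`.
[cite: BenfattoEtAl1978, Basic Lemma (4.7) p.152; §5 p.154 «After (d + 1) steps», p.159 «Collecting all the errors»; Appendix A pp.160–161;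
Balaban1985BackgroundPropagators, (1.16)–(1.18) p.180, Sect. E p.428 (class form; ours)] -/
theorem exp_cumulantSum_sub_le_integral_of_ledger_stop (hΛ : Λ.Nonempty)
    (hAs : ∀ e e', A e e' = A e' e) {γA : ℝ} (hγA0 : 0 < γA)
    (hγA : ∀ x : Λ → ℝ, γA * ∑ e, x e ^ 2 ≤ ∑ e, ∑ e', A e e' * x e * x e')
    {θ Jc V M V₂ M₂ V₄ : ℝ} (hθ : 0 < θ)
    (hJc : ∀ e : Λ, ∑ e' : Λ, |A e e'| * (Real.cosh (θ * Real.sqrt (∑ j, ((((e : B1Eq324BenfattoLemma.Site d) j : ℝ) - ((e' : B1Eq324BenfattoLemma.Site d) j : ℝ))) ^ 2)) - 1) ≤ Jc)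
    (hJcγ : Jc < γA)
    (hV : ∀ e : Λ, ∑ e' : Λ, Real.exp (-(θ * Real.sqrt (∑ j, ((((e : B1Eq324BenfattoLemma.Site d) j : ℝ) - ((e' : B1Eq324BenfattoLemma.Site d) j : ℝ))) ^ 2))) *
      (1 + Real.sqrt (∑ j, ((((e : B1Eq324BenfattoLemma.Site d) j : ℝ) - ((e' : B1Eq324BenfattoLemma.Site d) j : ℝ))) ^ 2)) ≤ V)
    (hM : ∀ e : Λ, ∑ e' : Λ, |A e e'| * (1 + Real.sqrt (∑ j, ((((e : B1Eq324BenfattoLemma.Site d) j : ℝ) - ((e' : B1Eq324BenfattoLemma.Site d) j : ℝ))) ^ 2)) ≤ M)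
    (hV₂ : ∀ e : Λ, ∑ e' : Λ, Real.exp (-(θ / 2 * Real.sqrt (∑ j, ((((e : B1Eq324BenfattoLemma.Site d) j : ℝ) - ((e' : B1Eq324BenfattoLemma.Site d) j : ℝ))) ^ 2))) ≤ V₂)
    (hM₂ : ∀ e : Λ, ∑ e' : Λ, |A e e'| * Real.exp (θ / 2 * Real.sqrt (∑ j, ((((e : B1Eq324BenfattoLemma.Site d) j : ℝ) - ((e' : B1Eq324BenfattoLemma.Site d) j : ℝ))) ^ 2)) ≤ M₂)
    (hV₄ : ∀ e : Λ, ∑ e' : Λ, Real.exp (-(θ / 4 * Real.sqrt (∑ j, ((((e : B1Eq324BenfattoLemma.Site d) j : ℝ) - ((e' : B1Eq324BenfattoLemma.Site d) j : ℝ))) ^ 2))) *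
      (1 + Real.sqrt (∑ j, ((((e : B1Eq324BenfattoLemma.Site d) j : ℝ) - ((e' : B1Eq324BenfattoLemma.Site d) j : ℝ))) ^ 2)) ≤ V₄)
    (hguard : Jc / (Real.cosh (θ * w) - 1) < γA)
    (hκ : 0 < κ) (hL2 : 2 * (2 * w + v) < L) (hw : 0 < w) (hv : v ≤ w) (hγ0 : 0 ≤ γ) (hγ1 : γ ≤ 1) (hAc0 : 0 ≤ Ac)
    {Js Is : ℕ → Finset (B1Eq324BenfattoLemma.Site d)} {as : ℕ → Coef d} {bs : ℕ → ℝ} {τ σ : ℕ → B1Eq324BenfattoLemma.Site d} {m : ℕ}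
    (hsupp : CoefSupportedIn (as 0) (Js 0))
    (hA : ∀ (p : ℕ) (Δ : Fin p → B1Eq324BenfattoLemma.Site d) (nn : Fin p → ℕ), |as 0 p Δ nn| ≤ Ac) (hJI : Js 0 ⊆ Is 0)
    (hrecJ : ∀ k < m, Js (k + 1) = (Js k).image (fun x => x + τ k) ∩ corridorsBar L w v (((Js k).image fun x => x + τ k).image (boxIndex L)))
    (hrecI : ∀ k < m, Is (k + 1) = (Is k).image fun x => x + τ k)
    (hreca : ∀ k < m, as (k + 1) = restrictCoef (shiftCoef (as k) (-τ k)) (corridorsBar L w v (((Js k).image fun x => x + τ k).image (boxIndex L))))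
    (hrecb : ∀ k < m, bs (k + 1) = γ * bs k) (hb : ∀ k < m, 1 ≤ bs k)
    (hsmall : ∀ k < m, ((L : ℝ) ^ d) * Real.exp (-(bs k ^ 2 / 4)) ≤ 1 / 6)
    (hσ0 : σ 0 = 0) (hrecσ : ∀ k < m, σ (k + 1) = σ k - τ k)
    (hΓΛ : ∀ k < m, corridors L w (((Js k).image fun x => x + τ k).image (boxIndex L)) ⊆ Λ.image fun y => y - σ (k + 1))
    (hBΛ : ∀ k, k < m → ∀ m ∈ (((Js k).image fun x => x + τ k).image (boxIndex L)), box L m ⊆ Λ.image fun y => y - σ (k + 1))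
    {Kbs : ℕ → B1Eq324BenfattoLemma.Site d → B1Eq324BenfattoLemma.Site d → B1Eq324BenfattoLemma.Site d → ℝ}
    (hKbs : ∀ k (hk : k < m) m (hm : m ∈ (((Js k).image fun x => x + τ k).image (boxIndex L))) x y, Kbs k m x y = if h : x ∈ shrink L m w ∧ y ∈ shrink L m w then
      (((A.submatrix (fun j : ↥(Λ.image fun y => y - σ (k + 1)) => (⟨(j : B1Eq324BenfattoLemma.Site d) + σ (k + 1), (mem_image_sub_iff (σ (k + 1))).mp j.2⟩ : Λ))
          (fun j : ↥(Λ.image fun y => y - σ (k + 1)) => (⟨(j : B1Eq324BenfattoLemma.Site d) + σ (k + 1), (mem_image_sub_iff (σ (k + 1))).mp j.2⟩ : Λ))).submatrix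
          (fun j : ↥(shrink L m w) => (⟨j, hBΛ k hk m hm (shrink_subset_box L m w j.2)⟩ : ↥(Λ.image fun y => y - σ (k + 1))))
          (fun j : ↥(shrink L m w) => (⟨j, hBΛ k hk m hm (shrink_subset_box L m w j.2)⟩ : ↥(Λ.image fun y => y - σ (k + 1)))))⁻¹ :
          Matrix ↥(shrink L m w) ↥(shrink L m w) ℝ) ⟨x, h.1⟩ ⟨y, h.2⟩ else 0)
    {Ku K₀ ε₃₁ : ℕ → ℝ} (hKuI : ∀ k < m, (1 + V * M / (γA - Jc)) * (γ * bs k) ≤ Ku k) (hKuK : ∀ k < m, Ku k ≤ K₀ k)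
    (hK₀ : ∀ k < m, 1 / (γA - Jc) ≤ K₀ k) (hK₀1 : ∀ k < m, 1 ≤ K₀ k)
    (hε₁ : ∀ k < m, V₂ * M₂ / (γA - Jc) ^ 2 * Real.exp (-(θ / 2 * ((w - v : ℕ) : ℝ))) + Real.exp (-(θ * ((w - v : ℕ) : ℝ))) / (γA - Jc) ≤ ε₃₁ k)
    (hε₂ : ∀ k < m, M₂ / (γA - Jc) * (γ * bs k) * (1 + Real.sqrt d * ((L : ℝ) - 1)) * V₄ * Real.exp (-(θ / 4 * ((w - v : ℕ) : ℝ))) ≤ ε₃₁ k)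
    (hhalf : 1 / γA ≤ 1 / 2) (hsmallγ : V * M / (γA - Jc) * γ ≤ 1 / 2)
    {δ : ℝ} (hδ : 0 < δ) (hδle : δ ≤ θ / Real.sqrt d) (hres : 0 < κ / 2 - δ / 2 * ((D : ℝ) ^ 2 * Real.sqrt d)) (t : ℕ)
    (hI0 : (Is 0).Nonempty) (hJm : Js m = ∅) (hbpos : 0 < bs m) (hbterm : 4 * (1 / γA) ≤ bs m ^ 2) {Etot : ℝ}
    (hledger : ∑ n ∈ Finset.range m,
        ((s1Const s D d κ * Ac * bs n ^ D * Real.exp (-(κ / 4 * w)) * (Js n).card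
          + s1Const s D d κ * Ac * bs n ^ D *
            (Real.exp (-(κ / 4 * w)) * (corridorsBar L w v (((Js n).image fun x => x + τ n).image (boxIndex L))).card +
              Real.exp (-(κ / 4 * v)) * ((((Js n).image fun x => x + τ n).image (boxIndex L)).card * (L : ℝ) ^ d))
          + 2 * ((∑ y : ↥((Λ.image fun y => y - σ (n + 1)) \ corridors L w (((Js n).image fun x => x + τ n).image (boxIndex L))),
              Jc / (Real.cosh (θ * max (w : ℝ) (distToRegion ((((Js n).image fun x => x + τ n).image (boxIndex L)).biUnion (box L)) y)) - 1)) / (γA - Jc / (Real.cosh (θ * w) - 1)) +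
            ((1 + V * M / (γA - Jc) * γ) ^ 2 * bs n ^ 2 *
            ∑ y : ↥((Λ.image fun y => y - σ (n + 1)) \ corridors L w (((Js n).image fun x => x + τ n).image (boxIndex L))),
              Jc / (Real.cosh (θ * max (w : ℝ) (distToRegion ((((Js n).image fun x => x + τ n).image (boxIndex L)).biUnion (box L)) y)) - 1) *
                (1 + distToRegion ((Is n).image fun x => x + τ n) y) ^ 2) / 2))
          + (∑ m ∈ (((Js n).image fun x => x + τ n).image (boxIndex L)),
              (2 * (2 ^ ((t + 1).choose 2) * (4 * (s1Const s D d κ * Ac * bs n ^ D * (L : ℝ) ^ d)) ^ (t + 1) / (t + 1)!) +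
                    Real.exp (2 * (4 * (s1Const s D d κ * Ac * bs n ^ D * (L : ℝ) ^ d))) *
                      (3 * (((shrink L m w).card : ℝ) * Real.exp (-(bs n ^ 2 / 4)))) +
                    ∑ k ∈ Finset.range t,
                      (3 ^ (k + 1) * ((∑ π ∈ setPartitions (univ : Finset (Fin (k + 1))), ((π.card - 1)! : ℝ)) *
                          (s1Const s D d κ * Ac * bs n ^ D * Real.exp (-(κ / 4 * v)) * (L : ℝ) ^ d *
                            (4 * (s1Const s D d κ * Ac * bs n ^ D * (L : ℝ) ^ d)) ^ k)) +
                        3 ^ (k + 1) * (2 ^ (k + 1) * ((∑ π ∈ setPartitions (univ : Finset (Fin (k + 1))), ((π.card - 1)! : ℝ)) *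
                            ((min 1 (2 * ((shrink L m w).card : ℝ) * Real.exp (-(bs n ^ 2 / 4)))) ^ ((2 * (k + 1) : ℕ) : ℝ)⁻¹ *
                              ((1 + Ku n) ^ D * (Ac * (L : ℝ) ^ d * ∑ p ∈ Finset.Icc 1 s, ((admissible p D).card : ℝ) *
              ((2 / (1 - Real.exp (-(κ / 2 / (p : ℕ) / Real.sqrt d))) * Real.exp (κ / 2 / (p : ℕ) / Real.sqrt d)) ^ d) ^ (p - 1)) * momentConst D (2 * (k + 1)) (K₀ n).toNNReal) ^ (k + 1))) +
                          2 ^ ((k + 1) * D) * 2 ^ 2 ^ ((k + 1) * D) * K₀ n ^ ((k + 1) * D) * Real.exp (-(δ / 2 * ((v : ℝ) + 1))) *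
                            (Ac * Real.exp (δ / 2 * ((D : ℝ) ^ 2 * d)) * (L : ℝ) ^ d * ∑ p ∈ Finset.Icc 1 s, ((admissible p D).card : ℝ) *
              ((2 / (1 - Real.exp (-((κ / 2 - δ / 2 * ((D : ℝ) ^ 2 * Real.sqrt d)) / (p : ℕ) / Real.sqrt d))) *
                Real.exp ((κ / 2 - δ / 2 * ((D : ℝ) ^ 2 * Real.sqrt d)) / (p : ℕ) / Real.sqrt d)) ^ d) ^ (p - 1)) ^ (k + 1)) +
                        3 ^ (k + 1) * (2 ^ (k + 1) * ((∑ π ∈ setPartitions (univ : Finset (Fin (k + 1))), ((π.card - 1)! : ℝ)) *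
                            ((min 1 (2 * ((shrink L m w).card : ℝ) * Real.exp (-(bs n ^ 2 / 4)))) ^ ((2 * (k + 1) : ℕ) : ℝ)⁻¹ *
                              ((1 + Ku n) ^ D * (Ac * (L : ℝ) ^ d * ∑ p ∈ Finset.Icc 1 s, ((admissible p D).card : ℝ) *
              ((2 / (1 - Real.exp (-(κ / 2 / (p : ℕ) / Real.sqrt d))) * Real.exp (κ / 2 / (p : ℕ) / Real.sqrt d)) ^ d) ^ (p - 1)) * momentConst D (2 * (k + 1)) (K₀ n).toNNReal) ^ (k + 1))) +
                          (Ac * (L : ℝ) ^ d * ∑ p ∈ Finset.Icc 1 s, ((admissible p D).card : ℝ) *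
              ((2 / (1 - Real.exp (-(κ / 2 / (p : ℕ) / Real.sqrt d))) * Real.exp (κ / 2 / (p : ℕ) / Real.sqrt d)) ^ d) ^ (p - 1)) ^ (k + 1) * (2 ^ ((k + 1) * D) * 2 ^ 2 ^ ((k + 1) * D) *
                            ((((k + 1) * D : ℕ) : ℝ) * K₀ n ^ ((k + 1) * D) * ε₃₁ n)))) / (k + 1)!) +
            ∑ k ∈ Finset.range t,
          ((2 ^ (k + 1) * (2 ^ ((k + 1) * D) * 2 ^ 2 ^ ((k + 1) * D) * K₀ n ^ ((k + 1) * D)) *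
          ((Ac * Real.exp (δ / 2 * ((D : ℝ) ^ 2 * d)) *
              Real.exp (-((κ / 2 - δ / 2 * ((D : ℝ) ^ 2 * Real.sqrt d)) / 2 * w))) * ((Js n).image fun x => x + τ n).card *
            ∑ p ∈ Finset.Icc 1 s, ((admissible p D).card : ℝ) *
              ((2 / (1 - Real.exp (-((κ / 2 - δ / 2 * ((D : ℝ) ^ 2 * Real.sqrt d)) / 2 / (p : ℕ) / Real.sqrt d))) *
                Real.exp ((κ / 2 - δ / 2 * ((D : ℝ) ^ 2 * Real.sqrt d)) / 2 / (p : ℕ) / Real.sqrt d)) ^ d) ^ (p - 1)) *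
          (Ac * Real.exp (δ / 2 * ((D : ℝ) ^ 2 * d)) *
            ((1 : ℝ) * (2 / (1 - Real.exp (-(δ / (2 * ((k + 1 : ℕ) : ℝ)) / Real.sqrt d))) * Real.exp (δ / (2 * ((k + 1 : ℕ) : ℝ)) / Real.sqrt d)) ^ d) *
            ∑ p ∈ Finset.Icc 1 s, ((admissible p D).card : ℝ) *
              ((2 / (1 - Real.exp (-((κ / 2 - δ / 2 * ((D : ℝ) ^ 2 * Real.sqrt d)) / (p : ℕ) / Real.sqrt d))) *
                Real.exp ((κ / 2 - δ / 2 * ((D : ℝ) ^ 2 * Real.sqrt d)) / (p : ℕ) / Real.sqrt d)) ^ d) ^ (p - 1)) ^ k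
          + 2 ^ (k + 1) * (2 ^ ((k + 1) * D) * 2 ^ 2 ^ ((k + 1) * D) * K₀ n ^ ((k + 1) * D)) *
        ((((Js n).image fun x => x + τ n).image (boxIndex L)).card * (Ac * Real.exp (δ / 2 * ((D : ℝ) ^ 2 * d)) * Real.exp (-((κ / 2 - δ / 2 * ((D : ℝ) ^ 2 * Real.sqrt d)) / 2 * v)) *
          (L : ℝ) ^ d * ∑ p ∈ Finset.Icc 1 s, ((admissible p D).card : ℝ) *
              ((2 / (1 - Real.exp (-((κ / 2 - δ / 2 * ((D : ℝ) ^ 2 * Real.sqrt d)) / 2 / (p : ℕ) / Real.sqrt d))) *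
                Real.exp ((κ / 2 - δ / 2 * ((D : ℝ) ^ 2 * Real.sqrt d)) / 2 / (p : ℕ) / Real.sqrt d)) ^ d) ^ (p - 1))) *
        (Ac * Real.exp (δ / 2 * ((D : ℝ) ^ 2 * d)) *
          (2 / (1 - Real.exp (-(δ / (2 * ((k + 1 : ℕ) : ℝ)) / Real.sqrt d))) * Real.exp (δ / (2 * ((k + 1 : ℕ) : ℝ)) / Real.sqrt d)) ^ d *
          ∑ p ∈ Finset.Icc 1 s, ((admissible p D).card : ℝ) *
              ((2 / (1 - Real.exp (-((κ / 2 - δ / 2 * ((D : ℝ) ^ 2 * Real.sqrt d)) / (p : ℕ) / Real.sqrt d))) *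
                Real.exp ((κ / 2 - δ / 2 * ((D : ℝ) ^ 2 * Real.sqrt d)) / (p : ℕ) / Real.sqrt d)) ^ d) ^ (p - 1)) ^ k)
          + (2 ^ (k + 1) * (2 ^ ((k + 1) * D) * 2 ^ 2 ^ ((k + 1) * D) * K₀ n ^ ((k + 1) * D)) *
          (Ac * Real.exp (δ / 2 * ((D : ℝ) ^ 2 * d)) * Real.exp (-((κ / 2 - δ / 2 * ((D : ℝ) ^ 2 * Real.sqrt d)) / 2 * w)) *
            (corridorsBar L w v (((Js n).image fun x => x + τ n).image (boxIndex L))).card * ∑ p ∈ Finset.Icc 1 s, ((admissible p D).card : ℝ) *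
              ((2 / (1 - Real.exp (-((κ / 2 - δ / 2 * ((D : ℝ) ^ 2 * Real.sqrt d)) / 2 / (p : ℕ) / Real.sqrt d))) *
                Real.exp ((κ / 2 - δ / 2 * ((D : ℝ) ^ 2 * Real.sqrt d)) / 2 / (p : ℕ) / Real.sqrt d)) ^ d) ^ (p - 1)) *
          (Ac * Real.exp (δ / 2 * ((D : ℝ) ^ 2 * d)) *
            (2 / (1 - Real.exp (-(δ / (2 * ((k + 1 : ℕ) : ℝ)) / Real.sqrt d))) * Real.exp (δ / (2 * ((k + 1 : ℕ) : ℝ)) / Real.sqrt d)) ^ d *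
            ∑ p ∈ Finset.Icc 1 s, ((admissible p D).card : ℝ) *
              ((2 / (1 - Real.exp (-((κ / 2 - δ / 2 * ((D : ℝ) ^ 2 * Real.sqrt d)) / (p : ℕ) / Real.sqrt d))) *
                Real.exp ((κ / 2 - δ / 2 * ((D : ℝ) ^ 2 * Real.sqrt d)) / (p : ℕ) / Real.sqrt d)) ^ d) ^ (p - 1)) ^ k
          + 2 ^ (k + 1) * (2 ^ ((k + 1) * D) * 2 ^ 2 ^ ((k + 1) * D) * K₀ n ^ ((k + 1) * D)) *
        ((((Js n).image fun x => x + τ n).image (boxIndex L)).card * (Ac * Real.exp (δ / 2 * ((D : ℝ) ^ 2 * d)) * Real.exp (-((κ / 2 - δ / 2 * ((D : ℝ) ^ 2 * Real.sqrt d)) / 2 * v)) *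
          (L : ℝ) ^ d * ∑ p ∈ Finset.Icc 1 s, ((admissible p D).card : ℝ) *
              ((2 / (1 - Real.exp (-((κ / 2 - δ / 2 * ((D : ℝ) ^ 2 * Real.sqrt d)) / 2 / (p : ℕ) / Real.sqrt d))) *
                Real.exp ((κ / 2 - δ / 2 * ((D : ℝ) ^ 2 * Real.sqrt d)) / 2 / (p : ℕ) / Real.sqrt d)) ^ d) ^ (p - 1))) *
        (Ac * Real.exp (δ / 2 * ((D : ℝ) ^ 2 * d)) *
          (2 / (1 - Real.exp (-(δ / (2 * ((k + 1 : ℕ) : ℝ)) / Real.sqrt d))) * Real.exp (δ / (2 * ((k + 1 : ℕ) : ℝ)) / Real.sqrt d)) ^ d *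
          ∑ p ∈ Finset.Icc 1 s, ((admissible p D).card : ℝ) *
              ((2 / (1 - Real.exp (-((κ / 2 - δ / 2 * ((D : ℝ) ^ 2 * Real.sqrt d)) / (p : ℕ) / Real.sqrt d))) *
                Real.exp ((κ / 2 - δ / 2 * ((D : ℝ) ^ 2 * Real.sqrt d)) / (p : ℕ) / Real.sqrt d)) ^ d) ^ (p - 1)) ^ k)
          + 2 ^ ((k + 1) * D) * 2 ^ 2 ^ ((k + 1) * D) * K₀ n ^ ((k + 1) * D) *
        ((((Js n).image fun x => x + τ n).image (boxIndex L)).card * (((k + 1 : ℕ) : ℝ) * (k : ℝ) *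
          ((Ac * Real.exp (δ / 2 * ((D : ℝ) ^ 2 * d)) * ((L : ℝ) ^ d * (2 / (1 - Real.exp (-(δ / (2 * ((k + 1 : ℕ) : ℝ)) / Real.sqrt d))) * Real.exp (δ / (2 * ((k + 1 : ℕ) : ℝ)) / Real.sqrt d)) ^ d) *
              ∑ p ∈ Finset.Icc 1 s, ((admissible p D).card : ℝ) *
              ((2 / (1 - Real.exp (-((κ / 2 - δ / 2 * ((D : ℝ) ^ 2 * Real.sqrt d)) / (p : ℕ) / Real.sqrt d))) *
                Real.exp ((κ / 2 - δ / 2 * ((D : ℝ) ^ 2 * Real.sqrt d)) / (p : ℕ) / Real.sqrt d)) ^ d) ^ (p - 1)) * ((Ac * Real.exp (δ / 2 * ((D : ℝ) ^ 2 * d)) * Real.exp (-(δ / (2 * ((k + 1 : ℕ) : ℝ)) / 2 * ((w : ℝ) + v + 1))) * ((L : ℝ) ^ d * (2 / (1 - Real.exp (-(δ / (2 * ((k + 1 : ℕ) : ℝ)) / 2 / Real.sqrt d))) * Real.exp (δ / (2 * ((k + 1 : ℕ) : ℝ)) / 2 / Real.sqrt d)) ^ d) *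
              ∑ p ∈ Finset.Icc 1 s, ((admissible p D).card : ℝ) *
              ((2 / (1 - Real.exp (-((κ / 2 - δ / 2 * ((D : ℝ) ^ 2 * Real.sqrt d)) / (p : ℕ) / Real.sqrt d))) *
                Real.exp ((κ / 2 - δ / 2 * ((D : ℝ) ^ 2 * Real.sqrt d)) / (p : ℕ) / Real.sqrt d)) ^ d) ^ (p - 1)) *
             (Ac * Real.exp (δ / 2 * ((D : ℝ) ^ 2 * d)) * ((L : ℝ) ^ d * (2 / (1 - Real.exp (-(δ / (2 * ((k + 1 : ℕ) : ℝ)) / Real.sqrt d))) * Real.exp (δ / (2 * ((k + 1 : ℕ) : ℝ)) / Real.sqrt d)) ^ d) *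
              ∑ p ∈ Finset.Icc 1 s, ((admissible p D).card : ℝ) *
              ((2 / (1 - Real.exp (-((κ / 2 - δ / 2 * ((D : ℝ) ^ 2 * Real.sqrt d)) / (p : ℕ) / Real.sqrt d))) *
                Real.exp ((κ / 2 - δ / 2 * ((D : ℝ) ^ 2 * Real.sqrt d)) / (p : ℕ) / Real.sqrt d)) ^ d) ^ (p - 1)) ^ (k - 1)))))
          + (((Js n).image fun x => x + τ n).image (boxIndex L)).card * ((3 : ℝ) ^ (k + 1) *
        (2 ^ ((k + 1) * D) * 2 ^ 2 ^ ((k + 1) * D) * K₀ n ^ ((k + 1) * D) *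
            Real.exp (-(δ / 2 * ((v : ℝ) + 1))) *
          (Ac * Real.exp (δ / 2 * ((D : ℝ) ^ 2 * d)) * (L : ℝ) ^ d * ∑ p ∈ Finset.Icc 1 s, ((admissible p D).card : ℝ) *
              ((2 / (1 - Real.exp (-((κ / 2 - δ / 2 * ((D : ℝ) ^ 2 * Real.sqrt d)) / (p : ℕ) / Real.sqrt d))) *
                Real.exp ((κ / 2 - δ / 2 * ((D : ℝ) ^ 2 * Real.sqrt d)) / (p : ℕ) / Real.sqrt d)) ^ d) ^ (p - 1)) ^ (k + 1)))) / (k + 1)!))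
        + (Is 0).card * (4 * 8 ^ d * Real.exp (-(bs m ^ 2 / (2 * (1 / γA))))) ≤ Etot) :
    Real.exp (cumulantSum (gaussianFieldOfKernel K) (hamiltonian s D κ (as 0) (Js 0)) t - Etot) ≤
      ∫ z, cutoffBoltzmann (hamiltonian s D κ (as 0) (Js 0)) (Is 0) (bs 0) z ∂gaussianFieldOfKernel K := by
  classical
  have hL : 0 < L := by omega
  have hA' : A.PosDef := posDef_of_coercive hAs hγA0 hγA
  have hKpsd : IsPosSemidefKernel K := isPosSemidefKernel_kernel hK hA'
  -- invariants along the chain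
  have hinv := chain_invariants (L := L) (w := w) (v := v) (n := m)
    (Bs := fun k => ((Js k).image fun x => x + τ k).image (boxIndex L)) hsupp hA hJI hrecJ hrecI hreca
  -- (2) one class lower step at every frame-`k` datum, from the class rows
  choose! ℓ hP using fun k (hk : k < m) =>
    exists_lower_step_of_classRows_frame hK (s := s) (D := D) (κ := κ) (a := as k) (J := Js k) (I := Is k) (L := L) (w := w) (v := v)
      (γ := γ) (b := bs k) (Ac := Ac) hΛ hAs hγA0 hγA hθ hJc hJcγ hV hM hV₂ hM₂ hV₄ hκ (hinv k hk.le).1 (hinv k hk.le).2.2.1 hAc0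
      (hinv k hk.le).2.1 hL2 hv (hb k hk) hγ0 hγ1 (hsmall k hk) (σ (k + 1)) (τ k) (hΓΛ k hk) (hBΛ k hk) (hKbs k hk)
      (hKuI k hk) (hKuK k hk) (hK₀ k hk) (hK₀1 k hk) (hε₁ k hk) (hε₂ k hk) hhalf hsmallγ hδ hδle hres t
  -- (1) the class lower chain for `m` steps down to the class Appendix A AT THE STOPPING INDEX (seat n08-d's driver
  --     `lowerPavementChain_appendixA_of_eq_empty`, consumed BY NAME), fed with the chosen exponents
  have hchainA := lowerPavementChain_appendixA_of_eq_empty hK hAs hγA0 hγA hθ hJc hJcγ hV hM hguard hκ hL hw hv hγ0 hγ1 hAc0 hsupp hA hJI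
    hrecJ hrecI hreca hrecb hb hσ0 hrecσ (Bs := fun k => ((Js k).image fun x => x + τ k).image (boxIndex L)) (fun k _ => subset_rfl) hΓΛ hBΛ
    hKbs ℓ (fun k hk => (hP k hk).1) hJm hI0 hbpos hbterm (s := s) (D := D)
  -- (3) collecting the errors
  refine exp_cumulantSum_sub_le_integral_of_chain hKpsd (as 0) (fun R _ z => rfl) hsupp hrecJ hreca hσ0 hrecσ hJm ℓ _ _ ?_
    (fun k hk => (hP k hk).2) hledger
  refine (congrArg Real.exp ?_).trans_le hchainA
  congr 1
  exact Finset.sum_congr rfl fun k _ => by ring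

end Assembly

end Literature.MathematicalPhysics.QuantumFieldTheory.Balaban1983to89.B1Eq324BenfattoKernelSect5LowerAssemblyStop

end
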